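import Summits.CriticalPhenomena.SAWScalingLimit.Theses.SAWConfRestriction

/-!
# `Assembly` (stmt-CriticalPhenomena-11212): the frame of route `SAWConfRestriction`

Assembly item stmt-CriticalPhenomena-11212: `LawlerSchrammWerner2003 → ConfCovLimit → RestrictionOfLimit → SimpleOfLimit →
SAWScalingLimit` (cone repair 2026-08-15: the LSW characterisation enters as an antecedent, the Literature named fact by name —
nothing is asserted about it here).  It is literally the term of the route's certified deciding theorem
`SAWConfRestriction.closes` (whose fourth hypothesis `LSWCharacterisation` is that fact by definition), with the antecedents
reordered.  [cite: LawlerSchrammWerner2003Restriction, Thm 8.4]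
-/

namespace Summit.CriticalPhenomena.SAWScalingLimit.Theorems

open Summit.CriticalPhenomena.SAWScalingLimit.Theses

/-- **`Assembly` (stmt-CriticalPhenomena-11212)** of route `SAWConfRestriction`: `LawlerSchrammWerner2003 → ConfCovLimit →
RestrictionOfLimit → SimpleOfLimit → SAWScalingLimit`, by the route's deciding theorem `closes`.
[cite: LawlerSchrammWerner2003Restriction, Thm 8.4] -/
theorem ConfRestrictionAssembly_proof : SAWConfRestriction.Assembly :=
  fun hLSW hcc hr hs => SAWConfRestriction.closes hcc hr hs hLSW

end Summit.CriticalPhenomena.SAWScalingLimit.Theorems
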